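import Mathlib
import HarnessLib
import Summits.HubbardSuperconductivity.HubbardSuperconductivity.Theorems.KLProgrammeKLRegimeEngineV8TowerExports
import Summits.HubbardSuperconductivity.HubbardSuperconductivity.Theorems.KLProgrammeKLRegimeEngineV8PairTransferExport
import Summits.HubbardSuperconductivity.HubbardSuperconductivity.Theorems.KLProgrammeKLRegimeEngineV8IsoTupleExport
import Summits.HubbardSuperconductivity.HubbardSuperconductivity.Theorems.KLProgrammeKLRegimeSplitGenericV3

/-!
# Skeleton v2 of `KLRegimeEngineV17F2` (stmt-HubbardSuperconductivity-20437): UNROLLING the export-class step Props along the scale ladder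
# (registrant's composition kit; cell gate-hubbard-kl, seat p1b g9 — 20437 registrant lineage)

The v2 internal export classes are typed as ONE-STEP Props with export histories — `LevelsUStep` (#1, …TowerExports), `PairTransferStep` (#5,
…PairTransferExport), `IsoTupleLineStep` (#6, …IsoTupleExport), `TwoLegMomentsStep` (#7, …TwoLegMomentsExport) — all on the same binder list (package
`Q₀.withCR r`, doors `klEngC₃6`/`klEngU₀9`/own threshold `u r cc`, `klEngL₃`/`klEngM₃`, `n ≤ n_β+1`, `IsKLRegime`, `HistP klPredsV17F2 … 0 n`, `FrameOK … K_n`).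
The v2 composition `engineP4_klPredsV17F2_of_stubs_v2` needs, at scale `n` with ONLY the public history `HistP … 0 n` in hand, the exports at EVERY
`j ≤ n`.  This file supplies that bookkeeping once, stub-text-independently:

* §1 `histP_klPredsV17F2_of_le` (history restriction `n ↦ j ≤ n`), `frameOK_klFlowFrameU_of_histP` (the flow frame `K_n` is admissible from the history,
  `n ≤ n_β + 1`: the hypothesis `h0 : FrameOK … 0` at `n = 0` (`klFrameOK_zeroC` in the render; kept a hypothesis so this module is route-independent), `frameOK_klFlowFrameU_succ` + `FrameOK.mono` at `n = N+1` — the v1 render's in-file `frameOK_flow_of_hist`);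
* §2 **`levelsUExportAt_all_of_step`** (self-contained history; + `levelsUExportAt_klCU_all_of_exists` from the tower's ∃-statement at the deferred
  table `klCU`/threshold `klCUu`), **`pairTransferFamilyCov_all_of_step`**, **`isoTupleLineAt_all_of_step`** (histories + the class-#1 exports at `klCU P R Q₀`
  at every `j ≤ n`): from the step Prop and the binders, `∀ j ≤ n, <export> j` — strong induction on the scale, the regime at every `j ≤ n_β+1` by
  `isKLRegime_of_le_nScales_succ`.  (Class #7 `TwoLegMomentsStep` — same shape as #1 — is unrolled in the companion module …ExportUnrollMoments.)

Proofs only; no definitions; nothing here asserts that any step Prop holds (they are the v2 stubs' content); nothing asserts superconductivity.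
References: BGM 2006 §2.4–§3 [cite: BenfattoGiulianiMastropietro2006].
-/

noncomputable section

namespace Summit.HubbardSuperconductivity.HubbardSuperconductivity.Theorems.EngineV8

set_option linter.dupNamespace false -- summit = problem name (single-conjunct summit), D-0017

open Real Finset Literature.MathematicalPhysics.QuantumLattice Literature.Probability.LatticeModels
open Literature.MathematicalPhysics.QuantumLattice.FermiRG
open Summit.HubbardSuperconductivity.HubbardSuperconductivity.Theorems.KLProgrammeLegKernels
open Summit.HubbardSuperconductivity.HubbardSuperconductivity.Theorems.DispersionFlow
open Summit.HubbardSuperconductivity.HubbardSuperconductivity.Theorems.KLRegimeSplit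

/-! ## §1 History restriction and the admissibility of the flow frame from the history -/

section Bookkeeping

variable {L M : ℕ} [NeZero L] [NeZero M] {G : GeoConsts} {P : SplitConsts} {Q : EngConsts} {R : RenConsts} {β U μ : ℝ} {K : TrigPolyC4v}

/-- **History restriction**: the V17F2 history up to `n` contains the history up to every `j ≤ n`. -/
theorem histP_klPredsV17F2_of_le {n j : ℕ} (h : HistP klPredsV17F2 L M G P Q R β U μ K n) (hj : j ≤ n) :
    HistP klPredsV17F2 L M G P Q R β U μ K j :=
  (histP_klPredsV17F2_iff L M G P Q R β U μ K j).2 fun m hm => (histP_klPredsV17F2_iff L M G P Q R β U μ K n).1 h m (lt_of_lt_of_le hm hj)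

/-- **The flow frame `K_n` is an admissible frame, from the history** (`n ≤ n_β + 1`; `n = 0`: `K_0 = 0`, `klFrameOK_zeroC`; `n = N+1`: (I-F jets) at every
`m ≤ N` and (I-F geometry) at `N` from the renormalisation slots of the history, `frameOK_klFlowFrameU_succ`, then `FrameOK.mono` from depth `N` to `n_β`).
The bare frame's admissibility `h0` is a hypothesis (`klFrameOK_zeroC` in the render) so that this module stays outside the route cone. -/
theorem frameOK_klFlowFrameU_of_histP (hR : R.WF2) (h0 : FrameOK R U (nScales β) μ 0) {n : ℕ} (hn : n ≤ nScales β + 1)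
    (hhist : HistP klPredsV17F2 L M G P Q R β U μ K n) : FrameOK R U (nScales β) μ (klFlowFrameU L M β U μ n) := by
  rcases n with _ | N
  · rw [klFlowFrameU_zero]
    exact h0
  · have hh := (histP_klPredsV17F2_iff L M G P Q R β U μ K (N + 1)).1 hhist
    have hJ : ∀ m ≤ N, FlowPieceJetsAt L M β U μ R m := fun m hm => (hh m (Nat.lt_succ_of_le hm)).2.1.2.1
    have hG : FlowGeometryAt L M β U μ N := (hh N (Nat.lt_succ_self N)).2.1.2.2
    exact FrameOK.mono hR.1.2.2 (by omega) (frameOK_klFlowFrameU_succ hJ hG)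

end Bookkeeping

/-! ## §2 Unrolling the step Props -/

section Unroll

variable {P : SplitConsts} {R : RenConsts} {Q₀ : EngConsts} {G : GeoConsts} {r cc μ U β : ℝ} {L M : ℕ} [NeZero L] [NeZero M]

/-- **CLASS #1 UNROLLED**: from `LevelsUStep P R Q₀ c u` and the binders at the package `Q₀.withCR r`, the public history up to `n ≤ n_β + 1` gives the
U-currency export at EVERY `j ≤ n`. -/
theorem levelsUExportAt_all_of_step {c : ℕ → ℝ} {u : ℝ → ℝ → ℝ} (hstep : LevelsUStep P R Q₀ c u) (hG : G.WF) (hr : Q₀.CR ≤ r)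
    (hcc0 : 0 < cc) (hcc : cc ≤ klEngC₃6 P R) (hμ : μ ∈ klWindowC) (h0 : FrameOK R U (nScales β) μ 0) (hU : 0 < U) (hU9 : U ≤ klEngU₀9 P R cc) (hUu : U ≤ u r cc)
    (hβ : klBetaMin ≤ β) (hβc : β ≤ Real.exp (cc / U ^ 2)) (hL : klEngL₃ β U ≤ L) (hM : klEngM₃ β U L ≤ M) (hR : R.WF2) :
    ∀ n : ℕ, n ≤ nScales β + 1 → HistP klPredsV17F2 L M G P (Q₀.withCR r) R β U μ 0 n → ∀ j ≤ n, LevelsUExportAt L M c P β U μ j := by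
  intro n
  induction n using Nat.strong_induction_on with
  | _ n ih =>
    intro hn hhist j hj
    rcases hj.lt_or_eq with hlt | rfl
    · exact ih j hlt (by omega) (histP_klPredsV17F2_of_le hhist hlt.le) j le_rfl
    · exact hstep G hG r hr cc hcc0 hcc μ hμ U hU hU9 hUu β hβ hβc L M hL hM j hn (isKLRegime_of_le_nScales_succ hcc0.le hβ hβc hn)
        hhist (frameOK_klFlowFrameU_of_histP hR h0 hn hhist)
        (fun i hi => ih i hi (by omega) (histP_klPredsV17F2_of_le hhist hi.le) i le_rfl)

/-- **CLASS #5 UNROLLED**: from `PairTransferStep P R Q₀ rT u`, the binders, the public history up to `n ≤ n_β + 1` AND the class-#1 exports at the deferred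
table `klCU P R Q₀` at every `j ≤ n`, the transfer export at EVERY `j ≤ n`. -/
theorem pairTransferFamilyCov_all_of_step {rT : ℝ} {u : ℝ → ℝ → ℝ} (hstep : PairTransferStep P R Q₀ rT u) (hG : G.WF) (hr : Q₀.CR ≤ r)
    (hcc0 : 0 < cc) (hcc : cc ≤ klEngC₃6 P R) (hμ : μ ∈ klWindowC) (h0 : FrameOK R U (nScales β) μ 0) (hU : 0 < U) (hU9 : U ≤ klEngU₀9 P R cc) (hUu : U ≤ u r cc)
    (hβ : klBetaMin ≤ β) (hβc : β ≤ Real.exp (cc / U ^ 2)) (hL : klEngL₃ β U ≤ L) (hM : klEngM₃ β U L ≤ M) (hR : R.WF2)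
    {n : ℕ} (hn : n ≤ nScales β + 1) (hhist : HistP klPredsV17F2 L M G P (Q₀.withCR r) R β U μ 0 n)
    (hlev : ∀ j ≤ n, LevelsUExportAt L M (klCU P R Q₀) P β U μ j) :
    ∀ j ≤ n, PairTransferFamilyCov L M G P rT β U μ j := by
  intro j
  induction j using Nat.strong_induction_on with
  | _ j ih =>
    intro hj
    have hjn : j ≤ nScales β + 1 := hj.trans hn
    have hhj := histP_klPredsV17F2_of_le hhist hj
    exact hstep G hG r hr cc hcc0 hcc μ hμ U hU hU9 hUu β hβ hβc L M hL hM j hjn (isKLRegime_of_le_nScales_succ hcc0.le hβ hβc hjn)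
      hhj (frameOK_klFlowFrameU_of_histP hR h0 hjn hhj) (fun i hi => hlev i (hi.trans hj)) (fun i hi => ih i hi (by omega))

/-- **CLASS #6 UNROLLED**: from `IsoTupleLineStep P R Q₀ a b u`, the binders, the public history up to `n ≤ n_β + 1` AND the class-#1 exports at `klCU P R Q₀`
at every `j ≤ n`, the iso fixed-tuple line at EVERY `j ≤ n`. -/
theorem isoTupleLineAt_all_of_step {a b : ℝ} {u : ℝ → ℝ → ℝ} (hstep : IsoTupleLineStep P R Q₀ a b u) (hG : G.WF) (hr : Q₀.CR ≤ r)
    (hcc0 : 0 < cc) (hcc : cc ≤ klEngC₃6 P R) (hμ : μ ∈ klWindowC) (h0 : FrameOK R U (nScales β) μ 0) (hU : 0 < U) (hU9 : U ≤ klEngU₀9 P R cc) (hUu : U ≤ u r cc)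
    (hβ : klBetaMin ≤ β) (hβc : β ≤ Real.exp (cc / U ^ 2)) (hL : klEngL₃ β U ≤ L) (hM : klEngM₃ β U L ≤ M) (hR : R.WF2)
    {n : ℕ} (hn : n ≤ nScales β + 1) (hhist : HistP klPredsV17F2 L M G P (Q₀.withCR r) R β U μ 0 n)
    (hlev : ∀ j ≤ n, LevelsUExportAt L M (klCU P R Q₀) P β U μ j) :
    ∀ j ≤ n, IsoTupleLineAt L M a b P β U μ j := by
  intro j
  induction j using Nat.strong_induction_on with
  | _ j ih =>
    intro hj
    have hjn : j ≤ nScales β + 1 := hj.trans hn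
    have hhj := histP_klPredsV17F2_of_le hhist hj
    exact hstep G hG r hr cc hcc0 hcc μ hμ U hU hU9 hUu β hβ hβc L M hL hM j hjn (isKLRegime_of_le_nScales_succ hcc0.le hβ hβc hjn)
      hhj (frameOK_klFlowFrameU_of_histP hR h0 hjn hhj) (fun i hi => hlev i (hi.trans hj)) (fun i hi => ih i hi (by omega))

/-- **CLASS #1 AT THE DEFERRED TABLE, from the existence statement** (the shape the tower lane delivers: `∃ e, IsExportPkg e ∧ LevelsUStep P R Q₀ e.1 e.2.2`):
below the deferred threshold `klCUu P R Q₀ r cc`, the exports at the table `klCU P R Q₀` at every `j ≤ n`. -/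
theorem levelsUExportAt_klCU_all_of_exists (hex : ∃ e : (ℕ → ℝ) × ℝ × (ℝ → ℝ → ℝ), IsExportPkg e ∧ LevelsUStep P R Q₀ e.1 e.2.2)
    (hG : G.WF) (hr : Q₀.CR ≤ r) (hcc0 : 0 < cc) (hcc : cc ≤ klEngC₃6 P R) (hμ : μ ∈ klWindowC) (h0 : FrameOK R U (nScales β) μ 0) (hU : 0 < U) (hU9 : U ≤ klEngU₀9 P R cc)
    (hUu : U ≤ klCUu P R Q₀ r cc) (hβ : klBetaMin ≤ β) (hβc : β ≤ Real.exp (cc / U ^ 2)) (hL : klEngL₃ β U ≤ L) (hM : klEngM₃ β U L ≤ M)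
    (hR : R.WF2) {n : ℕ} (hn : n ≤ nScales β + 1) (hhist : HistP klPredsV17F2 L M G P (Q₀.withCR r) R β U μ 0 n) :
    ∀ j ≤ n, LevelsUExportAt L M (klCU P R Q₀) P β U μ j :=
  levelsUExportAt_all_of_step (levelsUStep_klCU_of_exists hex) hG hr hcc0 hcc hμ h0 hU hU9 hUu hβ hβc hL hM hR n hn hhist

end Unroll

end Summit.HubbardSuperconductivity.HubbardSuperconductivity.Theorems.EngineV8

end
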